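import Literature.AnabelianGeometry.EtaleTheta.Discharge.Sec4Prop42SubLawFree
import Literature.AnabelianGeometry.EtaleTheta.Discharge.Sec4NonVacuityCoveringRemark411
import HarnessLib

/-!
# [EtTh] Prop. 4.2 (iii)/(iv), sub-DAG rows L04 `RootSquares`, L05 `UnitRootsUpstairs`, L06 `ZetaA`,
# L07 `ZetaB`: the instance forms with NO residual hypothesis, and the universal closure of L04 over
# the transport parameter REFUTED at the Kummer-tower toy

S. Mochizuki, *The étale theta function and its Frobenioid-theoretic manifestations*, Publ. RIMS **45**
(2009), §4, Prop. 4.2 (iii)/(iv), proof PDF p. 90 (printed p. 316) [cite: MochizukiEtTh2009, Prop 4.2 p.90]: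
L04 p.90 L6–9 «the existence of a pair of commutative diagrams … follows by translating the above
"scheme-theoretic observations" into the language of Frobenioids»; L05 p.90 L14–17 «it follows from the
"(N, H_⊙, f|_{A_N})-saturated-ness" condition … that the pull-back … of any element `∈ O^×(A_⊙)` … admits an
`N`-th root»; L06 p.90 L17–21 «the existence of a `ζ_A` …»; L07 p.90 L21–23 «the existence of a `ζ_B` …».

PROOF-ONLY companion (abc-iut cell, block F fact-proving wave, seat abc-iut-f-130, tranche 130; FACT-LIST
rows **F-2797** `Prop42Sub.RootSquares`, **F-2798** `Prop42Sub.UnitRootsUpstairs`, **F-2799**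
`Prop42Sub.ZetaA`, **F-2800** `Prop42Sub.ZetaB`) of abc-iut-w5-d134's statements file `Prop42Sub.lean`.
All four rows are SCHEMATA over the hypothesis structure `S : BiKummerSetting X T D VD` (`BiKummer.lean`:
the birational vocabulary `O^×(A^birat)`, `s'·(s'')⁻¹`, the `(N,H)`-saturation slot, "arise from a
base-Frobenius pair" are FREE fields) and an ARBITRARY transport `pullFrac` of birational units
("`((α')^birat)^*`").  Nothing landed is edited or restated; no `def`, no instance, no new named fact.
What is filed, per row:

* **F-2797 / L04 `RootSquares`.**  (a) `Prop42Sub.rootSquares_holds`: the instance form at abc-iut-L2-t9's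
  canonical model instance `mkOfModelCanonical` (every vocabulary, every tempered Frobenioid `tf`, the
  model transport `pullFracModel`) holds with NO residual hypothesis — abc-iut-w5-d134's
  `rootSquares_mkOfModel` (the [FrdI] Thm. 5.2 (ii) dictionary is the identity at the model).
  (b) `ToyCov.not_forall_pullFrac_rootSquares`: **the universal closure over the transport parameter is
  FALSE** already at abc-iut-w5-d063's GENUINE canonical setting `ToyCov.biKummerSetting` (Kummer-tower toy,
  p427822): for the transport «everything ↦ the constant `c²`» (`c ∈ ℂˣ`, `c² ≠ 1`) the hypotheses of L04
  are met by `f := 1`, the fraction-pairs `(𝟙, 𝟙)` downstairs and `(c, 𝟙)` upstairs and the degree-`2`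
  base-Frobenius-type isometry `α` of `ToyCov.exists_baseFrobeniusTypeData_two`, but the two squares force
  `c ∘ α = α`, i.e. `c² = 1`.  So the content of L04 is exactly the transport law
  `toB(((φ)^birat)^* x) = Base(φ)^* toB(x)` (hypothesis `hpull` of `rootSquares_of`), `rfl` at the model.
* **F-2800 / L07 `ZetaB`.**  `Prop42Sub.zetaB_holds`: at `mkOfModelCanonical` over the canonical [FrdI]
  category vocabulary `treeCatVocab` (so `Φ` divisorial is the interface field, abc-iut-w5-d120's
  `Sec4Prop42SubLawFree.lean` p430520) and the model transport, L07 holds with NO residual hypothesis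
  (`zetaB_treeCatVocab_of_dictionary` with the identity dictionary: `toB := id`,
  `hfrac := coe_fracOfModel_mul_unit`, `hpull := rfl`).
* **F-2798 / L05 `UnitRootsUpstairs`, F-2799 / L06 `ZetaA` — AT THE ROOTS READING.**
  `Prop42Sub.unitRootsUpstairs_holds`, `Prop42Sub.zetaA_holds`: at `mkOfModelCanonical` over `treeCatVocab`
  with the `(N, H_⊙^{bs-fld})`-saturation slot instantiated by abc-iut-w4-d044's ROOTS READING (p428987,
  `Sec4Prop42SubRootsReading.lean`: «every `Div_B`-trivial element of `B(A_⊙^bs)` acquires an `N`-th root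
  along every base arrow» — the consequence [FrdII] Rmk. 2.2.1 draws from Def. 2.2 (ii)(c), WEAKER than
  print's cohomological definition) both rows hold with NO residual hypothesis: `hL` (GAP-LEDGER
  G-w4d044-1) is tautological there (`constantRoots_rootsReading`) and `hE` is definitional at the
  canonical instance.  HONEST LABEL: these two witnesses are instance forms AT THAT READING; at the free
  `(N,H)`-slot the rows stay CONDITIONAL on `hL` BY NAME (`unitRootsUpstairs_treeCatVocab_of_constantRoots`,
  `zetaA_treeCatVocab_of_constantRoots`), and GAP row G-w4d044-1 stays OPEN at the faithful reading
  (owner: the L1↔L2 base-field hull identification).  The universal closures of L05/L06 are not decided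
  here: every tempered-Frobenioid toy in the tree has a divisible unit group (`Toy`: `O^× = 1`;
  `ToyCov`/`ToyCovZ`: `O^× = ℂˣ`), where L05 holds for every transport (`ToyCov.unitRootsUpstairs`).

HONEST FRAMING: [EtTh] is a refereed prerequisite paper; typed ≠ proved for the rows that keep named
inputs at the free slot; a FACT row is an assumption label, not an endorsement; nothing here bears on, or
takes a side on, [IUTchIII] Cor. 3.12.
-/

noncomputable section

namespace Literature.AnabelianGeometry.EtaleTheta

open CategoryTheory Opposite Literature.AlgebraicGeometry.Frobenioids

universe u₀ v₀ u v w

variable {K : Type u₀} [Field K]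

namespace BiKummerSetting

namespace Prop42Sub

/-! ## §A. F-2797 / L04 `RootSquares` at the canonical model instance: no residual hypothesis -/

section AnyVocab

variable (X : SemiGraphs.TemperedArithmeticGroup.{u₀} K) {D₀ : Type u₀} [Category.{v₀} D₀]
  {V : FrdIMonoidStub.{w}} {T : RealifiedDivisorMonoids (D₀ := D₀) V} {D : Type u} [Category.{v} D]
  {VD : FrdICatStub.{u, v, w} D}
  (tf : TemperedFrobenioid T D VD) (hZ : tf.monoidType = MonoidType.Z)
  (hP : ∀ A : Dᵒᵖ, IsPerfect (tf.Φ.carrier A)) (IG : D → Prop) (gS : ∀ A : D, IG A → (X.Pi →* Aut A))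
  (gSs : ∀ (A : D) (h : IG A), Function.Surjective (gS A h))
  (NH : Subgroup (Field.absoluteGaloisGroup K) → tf.category → ℕ+ → Prop) (A₀ : tf.category)
  (hA₀ : PreFrobenioid.IsFrobeniusTrivial tf.toElem A₀) (hA₀' : IG A₀.base)

/-- **F-2797 · [EtTh] Prop. 4.2 (iii), sub-node L04 `RootSquares`, INSTANCE FORM — no residual hypothesis.**
At the canonical model instance `mkOfModelCanonical` of the §4 setting (any [FrdI] vocabularies, any
tempered Frobenioid `tf` of monoid type `ℤ` with `Φ` perfect, any Galois data, any `(N,H)`-slot) with the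
model transport `((α')^birat)^* := B(Base α')`, the isometry `β : B_N → B` of Frobenius degree `N` closing
both squares `s' ∘ α = β ∘ s'_N`, `s'' ∘ α = β ∘ s''_N` EXISTS (abc-iut-w5-d134's `rootSquares_mkOfModel`:
`β := (N, Base(s'_N)⁻¹ ∘ Base(α) ∘ Base(s'), 0, (Base(s'_N)⁻¹)^*(u_{s'∘α} · u_{s'_N}^{-N}))`).
Printed step: proof of Prop. 4.2 (iii), PDF p.90 L6–9. [cite: MochizukiEtTh2009, Prop 4.2 p.90] -/
theorem rootSquares_holds :
    Literature.AnabelianGeometry.EtaleTheta.BiKummerSetting.Prop42Sub.RootSquares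
      (mkOfModelCanonical X tf hZ hP IG gS gSs NH A₀ hA₀ hA₀') (fun φ x => tf.pullFracModel φ x) :=
  rootSquares_mkOfModel tf hZ hP T.isUnit_BΛ _ IG gS gSs NH _ A₀ hA₀ hA₀'

end AnyVocab

/-! ## §B. F-2800 / L07, F-2798 / L05, F-2799 / L06 at the canonical model over `treeCatVocab` -/

section TreeVocab

variable (X : SemiGraphs.TemperedArithmeticGroup.{u₀} K) {D₀ : Type u₀} [Category.{v₀} D₀]
  {V : FrdIMonoidStub.{w}} {T : RealifiedDivisorMonoids (D₀ := D₀) V} {D : Type u} [Category.{v} D]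
  {IsRational IsStrictlyRational : (Dᵒᵖ ⥤ CommMonCat.{w}) → Prop}
  (tf : TemperedFrobenioid T D (treeCatVocab D IsRational IsStrictlyRational))
  (hZ : tf.monoidType = MonoidType.Z)
  (hP : ∀ A : Dᵒᵖ, IsPerfect (tf.Φ.carrier A)) (IG : D → Prop) (gS : ∀ A : D, IG A → (X.Pi →* Aut A))
  (gSs : ∀ (A : D) (h : IG A), Function.Surjective (gS A h))
  (NH : Subgroup (Field.absoluteGaloisGroup K) → tf.category → ℕ+ → Prop) (A₀ : tf.category)
  (hA₀ : PreFrobenioid.IsFrobeniusTrivial tf.toElem A₀) (hA₀' : IG A₀.base)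

/-- **F-2800 · [EtTh] Prop. 4.2 (iv), sub-node L07 `ZetaB`, INSTANCE FORM — no residual hypothesis.**
At the canonical model instance over the canonical [FrdI] category vocabulary `treeCatVocab` (`Φ`
divisorial = the interface field [EtTh] Def. 3.6 (ii)) with the model transport: given `ζ_A` over
`α, ᾱ`, there are `u ∈ μ_N(B_N)` and `ζ_B : B_N ⥲ B̄_N` with `s̄'_N ∘ ζ_A = ζ_B ∘ s'_N`,
`s̄''_N ∘ ζ_A = ζ_B ∘ u ∘ s''_N` — abc-iut-w5-d120's `zetaB_treeCatVocab_of_dictionary` with the identity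
dictionary of the model (`O^×(A^birat) := B(A_D)^×`, `s'·(s'')⁻¹ := u_{s'}·u_{s''}⁻¹`,
`((φ)^birat)^* := B(Base φ)`).  Printed step: PDF p.90 L21–23 with the statement p.89 L1–8.
[cite: MochizukiEtTh2009, Prop 4.2 p.90] -/
theorem zetaB_holds :
    Literature.AnabelianGeometry.EtaleTheta.BiKummerSetting.Prop42Sub.ZetaB
      (mkOfModelCanonical X tf hZ hP IG gS gSs NH A₀ hA₀ hA₀') (fun φ x => tf.pullFracModel φ x) :=
  zetaB_treeCatVocab_of_dictionary (mkOfModelCanonical X tf hZ hP IG gS gSs NH A₀ hA₀ hA₀')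
    (fun φ x => tf.pullFracModel φ x) (fun A => MonoidHom.id (tf.biratUnitsModel A))
    (fun s' s'' _ _ _ => coe_fracOfModel_mul_unit tf T.isUnit_BΛ s' s'') (fun _ _ => rfl)

/-- **F-2798 · [EtTh] Prop. 4.2 (iv), sub-node L05 `UnitRootsUpstairs`, INSTANCE FORM AT THE ROOTS READING —
no residual hypothesis.**  At the canonical model instance over `treeCatVocab` whose
`(N, H_⊙^{bs-fld})`-saturation slot is abc-iut-w4-d044's roots reading («every `Div_B`-trivial element of
`B(A_⊙^bs)` acquires an `N`-th root in `B(A^bs)` along every base arrow `A^bs ⟶ A_⊙^bs`», the consequence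
of [FrdII] Def. 2.2 (ii)(c) drawn in Rmk. 2.2.1), every unit of the `N`-domain `A_N` lying over a unit of
`A_⊙` along the pull-back part `α'` is an `N`-th power in `O^×(A_N)`: the roots-of-constants law `hL`
(GAP-LEDGER G-w4d044-1) is tautological there and the transport half is abc-iut-w4-d044's
`unitRootsUpstairs_of_constantRoots`.  HONEST LABEL: instance form AT THAT READING; at the free slot the
row is `unitRootsUpstairs_treeCatVocab_of_constantRoots (hL)`, G-w4d044-1 open at the faithful reading.
Printed step: PDF p.90 L14–17. [cite: MochizukiEtTh2009, Prop 4.2 p.90] -/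
theorem unitRootsUpstairs_holds :
    Literature.AnabelianGeometry.EtaleTheta.BiKummerSetting.Prop42Sub.UnitRootsUpstairs
      (mkOfModelCanonical X tf hZ hP IG gS gSs
        (fun _ A M => ∀ (b : A.base ⟶ A₀.base) (x : tf.ratFnFunctor.obj (op A₀.base)),
          divB tf.divisorMonoid tf.ratFnFunctor tf.divBNatTrans (op A₀.base) x = 1 →
            ∃ ζ : tf.ratFnFunctor.obj (op A.base), ζ ^ (M : ℕ) = pull tf.ratFnFunctor b x)
        A₀ hA₀ hA₀') (fun φ x => tf.pullFracModel φ x) :=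
  unitRootsUpstairs_treeCatVocab_of_constantRoots
    (mkOfModelCanonical X tf hZ hP IG gS gSs
        (fun _ A M => ∀ (b : A.base ⟶ A₀.base) (x : tf.ratFnFunctor.obj (op A₀.base)),
          divB tf.divisorMonoid tf.ratFnFunctor tf.divBNatTrans (op A₀.base) x = 1 →
            ∃ ζ : tf.ratFnFunctor.obj (op A.base), ζ ^ (M : ℕ) = pull tf.ratFnFunctor b x)
        A₀ hA₀ hA₀') (fun φ x => tf.pullFracModel φ x)
    (fun _ _ g ξ _ hNH hξ => hNH g ξ hξ)

/-- **F-2799 · [EtTh] Prop. 4.2 (iv), sub-node L06 `ZetaA`, INSTANCE FORM AT THE ROOTS READING — no residual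
hypothesis.**  At the canonical model instance over `treeCatVocab` with the roots reading of the
`(N, H_⊙^{bs-fld})`-saturation slot: for two `N`-th roots of the same fraction-pair and a base isomorphism
`Ā' : A_N^bs ⥲ Ā_N^bs` with `ᾱ^bs ∘ Ā' = α^bs` there is `ζ_A : A_N ⥲ Ā_N` with `α = ᾱ ∘ ζ_A`, `ζ_A^bs = Ā'`
— abc-iut-w4-d044's `zetaA_of_unitRootsUpstairs` (naturality of the Frobenius sections along `α'`, [FrdI]
Def. 1.3 (ii) at `A_⊙`, the pull-back property of `α', ᾱ'`, L05, Frobenius-normalisation), with `hE`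
("arise from a base-Frobenius pair" ⇒ [FrdI] Def. 2.7) definitional at the canonical instance and `hL`
tautological at the reading.  HONEST LABEL: instance form AT THAT READING; at the free slot the row is
`zetaA_treeCatVocab_of_constantRoots (hE) (hL)`, G-w4d044-1 open at the faithful reading.
Printed step: PDF p.90 L17–21. [cite: MochizukiEtTh2009, Prop 4.2 p.90] -/
theorem zetaA_holds :
    Literature.AnabelianGeometry.EtaleTheta.BiKummerSetting.Prop42Sub.ZetaA
      (mkOfModelCanonical X tf hZ hP IG gS gSs
        (fun _ A M => ∀ (b : A.base ⟶ A₀.base) (x : tf.ratFnFunctor.obj (op A₀.base)),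
          divB tf.divisorMonoid tf.ratFnFunctor tf.divBNatTrans (op A₀.base) x = 1 →
            ∃ ζ : tf.ratFnFunctor.obj (op A.base), ζ ^ (M : ℕ) = pull tf.ratFnFunctor b x)
        A₀ hA₀ hA₀') (fun φ x => tf.pullFracModel φ x) :=
  zetaA_treeCatVocab_of_constantRoots
    (mkOfModelCanonical X tf hZ hP IG gS gSs
        (fun _ A M => ∀ (b : A.base ⟶ A₀.base) (x : tf.ratFnFunctor.obj (op A₀.base)),
          divB tf.divisorMonoid tf.ratFnFunctor tf.divBNatTrans (op A₀.base) x = 1 →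
            ∃ ζ : tf.ratFnFunctor.obj (op A.base), ζ ^ (M : ℕ) = pull tf.ratFnFunctor b x)
        A₀ hA₀ hA₀') (fun φ x => tf.pullFracModel φ x)
    (fun _ _ _ h => h) (fun _ _ g ξ _ hNH hξ => hNH g ξ hξ)

end TreeVocab

end Prop42Sub

end BiKummerSetting

/-! ## §C. F-2797: the universal closure of L04 over the transport parameter is FALSE (Kummer-tower toy) -/

namespace ToyCov

open scoped NNRat

/-- **L04 `RootSquares` FAILS at the genuine Kummer-tower setting for a perverse transport.**  For the
transport `pullFrac` sending every birational unit to (the fraction of) the constant `c²` (`c² ≠ 1`) and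
any `α : A_⊙ → A_⊙` of base-Frobenius type of Frobenius degree `2` (an isometry: `α'` is a pull-back
morphism over a divisorial `Φ`, `α''` is of Frobenius type): with `f := 1` (fraction-pair `(𝟙, 𝟙)`),
`g := c` (fraction-pair `(c, 𝟙)`, `c` = multiplication by the constant), all hypotheses of L04 hold
(`g² = c² =` the transport of `f`, all divisors `0`), but the two squares `β ∘ c = α ∘ 𝟙`, `β ∘ 𝟙 = α ∘ 𝟙`
(diagrammatic: `c ≫ β = α`, `β = α`) force `c ≫ α = α`, whence `u_α · c² = u_α` in `B(A_⊙^bs)` ([FrdI]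
Thm. 5.2 (i): `u_{α∘c} = Base(c)^* u_α · u_c^{deg α}`) and `c² = 1`. [cite: MochizukiEtTh2009, Prop 4.2 p.90] -/
theorem not_rootSquares_of_baseFrobeniusTypeData {α : Aodot ⟶ Aodot}
    (d : biKummerSetting.BaseFrobeniusTypeData α) (hdeg : ModelFrobenioid.degFr α = 2)
    (c : ℂˣ) (hc : c ^ 2 ≠ 1) :
    ¬ BiKummerSetting.Prop42Sub.RootSquares biKummerSetting
        (fun {_ A'} _ _ => temperedFrobenioid.fracOfModel realified.isUnit_BΛ
          (coefAut A' c).hom (𝟙 A') ^ ((2 : ℕ+) : ℕ)) := by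
  intro h
  -- `α = α'' ≫ α'` is an isometry: `α'` is a pull-back morphism (`Φ` divisorial), `α''` of Frobenius type
  have hdiv : ModelFrobenioid.div α = 1 := by
    obtain ⟨-, hd1⟩ :=
      ModelFrobenioid.degFr_div_of_isPullbackMorphism divisorMonoid_isDivisorial d.cond_d
    have hd2 : ModelFrobenioid.div d.α₂ = 1 := d.cond_c.2.1.2
    rw [← d.fac]
    exact (ModelFrobenioid.div_comp_pull d.α₂ d.α₁).trans (by rw [hd1, map_one, one_mul, hd2, one_pow])
  -- pre-steps `𝟙` and `c`, with trivial divisors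
  have hpre1 : ∀ A : temperedFrobenioid.category, biKummerSetting.IsPreStep (𝟙 A) := fun A =>
    ⟨rfl, show IsIso (𝟙 (ModelFrobenioid.base A)) from inferInstance⟩
  have hprec : ∀ A : temperedFrobenioid.category, biKummerSetting.IsPreStep (coefAut A c).hom := fun A =>
    ⟨(coefAut_mem_units A c).2, by
      change IsIso (ModelFrobenioid.baseMap (coefAut A c).hom)
      rw [(coefAut_mem_units A c).1]
      infer_instance⟩
  have hsharp : ∀ (A : temperedFrobenioid.category) (x : temperedFrobenioid.Φ.carrier (op A.base)),
      x ∣ (1 : temperedFrobenioid.Φ.carrier (op A.base)) → x = 1 := fun A x hx =>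
    (divisorMonoid_isDivisorial A.base).isSharp.eq_one_of_isUnit x (isUnit_of_dvd_one hx)
  -- the fraction-pair `(𝟙, 𝟙)` downstairs, for `f := 𝟙 · 𝟙⁻¹`
  let P : biKummerSetting.FractionPair
      (biKummerSetting.fracOf (𝟙 Aodot) (𝟙 Aodot) (hpre1 Aodot) (hpre1 Aodot) rfl) Aodot :=
    { num := 𝟙 Aodot
      den := 𝟙 Aodot
      isPreStep_num := hpre1 Aodot
      isPreStep_den := hpre1 Aodot
      base_eq := rfl
      frac_eq := rfl
      disjointSupports := fun x hx _ => hsharp Aodot x hx }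
  -- the fraction-pair `(c, 𝟙)` upstairs, for `g := c · 𝟙⁻¹`
  have hbase : PreFrobenioid.BaseEquivalent biKummerSetting.F (coefAut Aodot c).hom (𝟙 Aodot) := by
    change ModelFrobenioid.baseMap (coefAut Aodot c).hom = ModelFrobenioid.baseMap (𝟙 Aodot)
    rw [(coefAut_mem_units Aodot c).1, ModelFrobenioid.baseMap_id]
  let Q : biKummerSetting.FractionPair
      (biKummerSetting.fracOf (coefAut Aodot c).hom (𝟙 Aodot) (hprec Aodot) (hpre1 Aodot) hbase) Aodot :=
    { num := (coefAut Aodot c).hom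
      den := 𝟙 Aodot
      isPreStep_num := hprec Aodot
      isPreStep_den := hpre1 Aodot
      base_eq := hbase
      frac_eq := rfl
      disjointSupports := fun x _ hx => hsharp Aodot x hx }
  -- all divisor hypotheses are `0 = 0`
  have hQn : biKummerSetting.div Q.num ^ ((2 : ℕ+) : ℕ) =
      pull biKummerSetting.tf.divisorMonoid (ModelFrobenioid.baseMap d.α₁) (biKummerSetting.div P.num) := by
    change (1 : temperedFrobenioid.Φ.carrier (op Aodot.base)) ^ ((2 : ℕ+) : ℕ) =
      pull temperedFrobenioid.divisorMonoid (ModelFrobenioid.baseMap d.α₁) 1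
    rw [one_pow, map_one]
    rfl
  have hQd : biKummerSetting.div Q.den ^ ((2 : ℕ+) : ℕ) =
      pull biKummerSetting.tf.divisorMonoid (ModelFrobenioid.baseMap d.α₁) (biKummerSetting.div P.den) := by
    change (1 : temperedFrobenioid.Φ.carrier (op Aodot.base)) ^ ((2 : ℕ+) : ℕ) =
      pull temperedFrobenioid.divisorMonoid (ModelFrobenioid.baseMap d.α₁) 1
    rw [one_pow, map_one]
    rfl
  obtain ⟨β, -, -, hcn, hcd⟩ := h _ P 2 Aodot α d _ Aodot Q hdiv hdeg rfl hQn hQd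
  change (coefAut Aodot c).hom ≫ β = α ≫ 𝟙 Aodot at hcn
  change 𝟙 Aodot ≫ β = α ≫ 𝟙 Aodot at hcd
  rw [Category.id_comp, Category.comp_id] at hcd
  rw [Category.comp_id, hcd] at hcn
  -- units: `u_α · c² = u_α`
  have hu := congrArg ModelFrobenioid.unit hcn
  rw [ModelFrobenioid.unit_comp_pull, (coefAut_mem_units Aodot c).1, pull_id, hdeg] at hu
  haveI : IsCancelMul (temperedFrobenioid.ratFnFunctor.obj (op Aodot.base)) :=
    isIntegral_iff_isCancelMul.mp (ratFnFunctor_isGroupLike Aodot.base).isPreDivisorial.isIntegral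
  have hc2 : ModelFrobenioid.unit (coefAut Aodot c).hom ^ ((2 : ℕ+) : ℕ) = 1 :=
    mul_left_cancel (hu.trans (mul_one _).symm)
  -- `u_c = c`, and the constants embed
  have hc2' : (cnstUnitHom Aodot (c ^ 2) : temperedFrobenioid.ratFnFunctor.obj (op Aodot.base)) = 1 := by
    rw [map_pow, Units.val_pow_eq_pow_val]
    exact hc2
  exact hc (cnstUnitHom_injective Aodot ((Units.val_eq_one.mp hc2').trans (map_one _).symm))

/-- **F-2797 · the universal closure of L04 `RootSquares` over the transport parameter is FALSE**: at
abc-iut-w5-d063's genuine Kummer-tower setting `ToyCov.biKummerSetting` (canonical model instance over the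
toy tempered Frobenioid `B = ℂˣ × (ℚ_{≥0})^gp`, p427822) there is a transport `pullFrac` for which L04
fails — the constant transport `x ↦ 2²` with the degree-`2` base-Frobenius-type isometry of
`exists_baseFrobeniusTypeData_two`.  Hence `Prop42Sub.RootSquares` is a SCHEMA whose content is the
transport law `((φ)^birat)^* ↔ B(Base φ)` (hypothesis `hpull` of `rootSquares_of`; `rfl` at the model,
where the row HOLDS: `Prop42Sub.rootSquares_holds`). [cite: MochizukiEtTh2009, Prop 4.2 p.90] -/
theorem not_forall_pullFrac_rootSquares :
    ¬ ∀ pullFrac : ∀ {A A' : biKummerSetting.C} (_ : A' ⟶ A),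
        biKummerSetting.biratUnits A → biKummerSetting.biratUnits A',
      BiKummerSetting.Prop42Sub.RootSquares biKummerSetting pullFrac := by
  intro h
  obtain ⟨d, -⟩ := exists_baseFrobeniusTypeData_two
  have h2 : (Units.mk0 (2 : ℂ) two_ne_zero) ^ 2 ≠ 1 := by
    intro h1
    have h1' := congrArg (fun u : ℂˣ => (u : ℂ)) h1
    norm_num at h1'
  exact not_rootSquares_of_baseFrobeniusTypeData d rfl (Units.mk0 (2 : ℂ) two_ne_zero) h2
    (h fun {_ A'} _ _ => temperedFrobenioid.fracOfModel realified.isUnit_BΛ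
      (coefAut A' (Units.mk0 (2 : ℂ) two_ne_zero)).hom (𝟙 A') ^ ((2 : ℕ+) : ℕ))

/-- **F-2797 settled as a schema**: the instance form HOLDS at the Kummer-tower setting with the model
transport (as at every canonical model instance, `Prop42Sub.rootSquares_holds`) AND the universal closure
over the transport FAILS there. [cite: MochizukiEtTh2009, Prop 4.2 p.90] -/
theorem rootSquares_and_not_forall :
    BiKummerSetting.Prop42Sub.RootSquares biKummerSetting
        (fun φ x => temperedFrobenioid.pullFracModel φ x) ∧
      ¬ ∀ pullFrac : ∀ {A A' : biKummerSetting.C} (_ : A' ⟶ A),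
          biKummerSetting.biratUnits A → biKummerSetting.biratUnits A',
        BiKummerSetting.Prop42Sub.RootSquares biKummerSetting pullFrac :=
  ⟨BiKummerSetting.Prop42Sub.rootSquares_holds Toy.temperedGroup temperedFrobenioid
      temperedFrobenioid_monoidType temperedFrobenioid_isPerfect (fun _ => True) (fun _ _ => 1)
      galoisSurj_surjective (fun _ _ _ => True) Aodot isFrobeniusTrivial_Aodot trivial,
    not_forall_pullFrac_rootSquares⟩

end ToyCov

end Literature.AnabelianGeometry.EtaleTheta

end
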